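import Summits.AtomisticToContinuum.Crystallization.Theorems.FrustratedLawDichotomyStrainedPatchHomLeafTableFold

/-!
# v2 leaf checker — per-record INTEGER IDENTITIES and the accumulator sums (second layer of the soundness proof)

decomp-a2c hand-1 g20 (crux `AperiodicFrustratedLawGap`, stmt-AtomisticToContinuum-27623; critic row 806 (2)(C)).  What the ℕ-encoded sign-split
arithmetic of `…HomLeafTableCheck` MEANS in `ℤ`: `qPos − qNeg = Σᵢⱼ bᵢbⱼ·cᵢⱼ` (class-summed centre), `rad = Σᵢⱼ |bᵢbⱼ|·wᵢⱼ`, and for a treated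
label the increment's signed fields: value `±aV`, centre correction `Dm·δ`, `Σδ`, the six gradient classes `Dm·L_class`, curvature `M(δ + r)²`;
plus the fieldwise sums of the final accumulator over the treated labels (`acc_sums`).  0 sorry; standard axioms.
`--supports stmt-AtomisticToContinuum-27623`.
-/

namespace Summit.AtomisticToContinuum.Crystallization.Theorems.FrustratedLawDichotomyStrainedPatchHomLeafTableCheck

/-! ## §1. Sign–magnitude algebra -/

/-- `addP s x 0 − addN s x 0 = ±x`. [formal bookkeeping] -/
theorem addP_sub_addN (s : Bool) (x : ℕ) : ((addP s x 0 : ℕ) : ℤ) - ((addN s x 0 : ℕ) : ℤ) = sgnZ s x := by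
  cases s <;> simp [addP, addN, sgnZ]

/-- `sgnZ s (x·y) = sgnZ s x · y`. [formal bookkeeping] -/
theorem sgnZ_mul (s : Bool) (x y : ℕ) : sgnZ s (x * y) = sgnZ s x * (y : ℤ) := by
  cases s <;> simp [sgnZ]

/-- `sgnZ (sx a b) (x·y) = sgnZ a x · sgnZ b y`. [formal bookkeeping] -/
theorem sgnZ_sx (a b : Bool) (x y : ℕ) : sgnZ (sx a b) (x * y) = sgnZ a x * sgnZ b y := by
  cases a <;> cases b <;> simp [sgnZ, sx]

/-- `0 ≤ addP s x 0 ≤ x` and the same for `addN` (used for the class-sum bound). [formal bookkeeping] -/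
theorem addP_le (s : Bool) (x : ℕ) : addP s x 0 ≤ x := by cases s <;> simp [addP]

/-- see `addP_le`. [formal bookkeeping] -/
theorem addN_le (s : Bool) (x : ℕ) : addN s x 0 ≤ x := by cases s <;> simp [addN]

/-! ## §2. The centre value and the radius in `ℤ` -/

/-- Unpacking `NL.ok`. [formal bookkeeping] -/
theorem NL.ok_iff (l : NL) : l.ok = true ↔
    (l.n : ℤ) = l.b0 * l.b0 + l.b1 * l.b1 + l.b2 * l.b2 + l.b0 * l.b1 + l.b0 * l.b2 + l.b1 * l.b2 ∧
    (l.m00 : ℤ) = l.b0 * l.b0 ∧ (l.m11 : ℤ) = l.b1 * l.b1 ∧ (l.m22 : ℤ) = l.b2 * l.b2 ∧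
    sgnZ l.s01 l.m01 = l.b0 * l.b1 ∧ sgnZ l.s02 l.m02 = l.b0 * l.b2 ∧ sgnZ l.s12 l.m12 = l.b1 * l.b2 := by
  unfold NL.ok
  simp only [Bool.and_eq_true, decide_eq_true_eq, and_assoc]

/-- `|sgnZ s m| = m`. [formal bookkeeping] -/
theorem natAbs_sgnZ (s : Bool) (m : ℕ) : (sgnZ s m).natAbs = m := by cases s <;> simp [sgnZ]

/-- ★ The centre value: `qPos − qNeg = b0²c0 + b1²c1 + b2²c2 + b0b1·c3 + b0b2·c4 + b1b2·c5` (in `ℤ`). [formal bookkeeping] -/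
theorem qPos_sub_qNeg {l : NL} (hl : l.ok = true) (k : LK) :
    ((qPos k l : ℕ) : ℤ) - ((qNeg k l : ℕ) : ℤ) =
      l.b0 * l.b0 * k.c0 + l.b1 * l.b1 * k.c1 + l.b2 * l.b2 * k.c2 + l.b0 * l.b1 * k.c3 + l.b0 * l.b2 * k.c4 + l.b1 * l.b2 * k.c5 := by
  obtain ⟨-, h00, h11, h22, h01, h02, h12⟩ := (NL.ok_iff l).1 hl
  unfold qPos qNeg
  simp only [Nat.add_eq, Nat.mul_eq]
  rw [addP_eq l.s01, addP_eq l.s02, addN_eq l.s01, addN_eq l.s02]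
  have e01 := addP_sub_addN l.s01 (l.m01 * k.c3)
  have e02 := addP_sub_addN l.s02 (l.m02 * k.c4)
  have e12 := addP_sub_addN l.s12 (l.m12 * k.c5)
  rw [sgnZ_mul] at e01 e02 e12
  rw [h01] at e01; rw [h02] at e02; rw [h12] at e12
  push_cast at e01 e02 e12 ⊢
  rw [← h00, ← h11, ← h22]
  linarith

/-- ★ The radius: `rad = b0²w0 + b1²w1 + b2²w2 + |b0b1|·w3 + |b0b2|·w4 + |b1b2|·w5` (in `ℤ`). [formal bookkeeping] -/
theorem rad_eq {l : NL} (hl : l.ok = true) (k : LK) :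
    ((rad k l : ℕ) : ℤ) = l.b0 * l.b0 * k.w0 + l.b1 * l.b1 * k.w1 + l.b2 * l.b2 * k.w2 +
      |l.b0 * l.b1| * k.w3 + |l.b0 * l.b2| * k.w4 + |l.b1 * l.b2| * k.w5 := by
  obtain ⟨-, h00, h11, h22, h01, h02, h12⟩ := (NL.ok_iff l).1 hl
  unfold rad
  simp only [Nat.add_eq, Nat.mul_eq]
  have a01 : ((l.m01 : ℕ) : ℤ) = |l.b0 * l.b1| := by rw [← h01, ← Int.natCast_natAbs, natAbs_sgnZ]
  have a02 : ((l.m02 : ℕ) : ℤ) = |l.b0 * l.b2| := by rw [← h02, ← Int.natCast_natAbs, natAbs_sgnZ]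
  have a12 : ((l.m12 : ℕ) : ℤ) = |l.b1 * l.b2| := by rw [← h12, ← Int.natCast_natAbs, natAbs_sgnZ]
  push_cast
  rw [h00, h11, h22, a01, a02, a12]
  ring

/-! ## §3. The increment of a treated label -/

/-- The row of a treated label exists and passes the range test. [formal bookkeeping] -/
theorem rowOf_of_treated {tab : QT} {k : LK} {l : NL} (h : treated tab k l = true) :
    Nat.ble (qNeg k l + rad k l) (qPos k l) = true ∧ farB k l = false ∧ ∃ row, rowOf tab k l = some row ∧ rangeB k l row = true := by
  unfold treated at h
  simp only [Bool.and_eq_true, Bool.not_eq_true'] at h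
  obtain ⟨⟨h1, h2⟩, h3⟩ := h
  refine ⟨h1, h2, ?_⟩
  cases hr : rowOf tab k l with
  | none => rw [hr] at h3; exact Bool.noConfusion h3
  | some row => rw [hr] at h3; exact ⟨row, rfl, h3⟩

/-- The increment of a treated label with row `row`: its signed fields. [formal bookkeeping] -/
theorem incr_fields {tab : QT} {k : LK} {l : NL} {row : Row} (h : treated tab k l = true) (hr : rowOf tab k l = some row) :
    (incr tab k l).ok = true ∧
    (((incr tab k l).vP : ℕ) : ℤ) - (incr tab k l).vN = sgnZ row.sV row.aV ∧
    (((incr tab k l).dP : ℕ) : ℤ) - (incr tab k l).dN = sgnZ row.sD row.aD * ((q0N k l - row.t : ℕ) : ℤ) ∧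
    (incr tab k l).sd = q0N k l - row.t ∧
    (((incr tab k l).g0P : ℕ) : ℤ) - (incr tab k l).g0N = sgnZ row.sD row.aD * (l.m00 : ℤ) ∧
    (((incr tab k l).g1P : ℕ) : ℤ) - (incr tab k l).g1N = sgnZ row.sD row.aD * (l.m11 : ℤ) ∧
    (((incr tab k l).g2P : ℕ) : ℤ) - (incr tab k l).g2N = sgnZ row.sD row.aD * (l.m22 : ℤ) ∧
    (((incr tab k l).g3P : ℕ) : ℤ) - (incr tab k l).g3N = sgnZ row.sD row.aD * sgnZ l.s01 l.m01 ∧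
    (((incr tab k l).g4P : ℕ) : ℤ) - (incr tab k l).g4N = sgnZ row.sD row.aD * sgnZ l.s02 l.m02 ∧
    (((incr tab k l).g5P : ℕ) : ℤ) - (incr tab k l).g5N = sgnZ row.sD row.aD * sgnZ l.s12 l.m12 ∧
    (incr tab k l).cur = row.M * ((q0N k l - row.t + rad k l) * (q0N k l - row.t + rad k l)) := by
  unfold incr
  rw [h, hr]
  dsimp only [step4, acc0]
  refine ⟨rfl, ?_, ?_, ?_, ?_, ?_, ?_, ?_, ?_, ?_, ?_⟩ <;> (try simp only [Nat.add_eq, Nat.mul_eq, Nat.zero_add])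
  · exact addP_sub_addN _ _
  · rw [addP_sub_addN, sgnZ_mul]
  · rw [addP_sub_addN, sgnZ_mul]
  · rw [addP_sub_addN, sgnZ_mul]
  · rw [addP_sub_addN, sgnZ_mul]
  · rw [addP_sub_addN, sgnZ_sx]
  · rw [addP_sub_addN, sgnZ_sx]
  · rw [addP_sub_addN, sgnZ_sx]

/-- Class magnitudes of an increment are at most `aD · m` (for the class-sum bound). [formal bookkeeping] -/
theorem incr_gP_add_gN_le {tab : QT} {k : LK} {l : NL} {row : Row} (h : treated tab k l = true) (hr : rowOf tab k l = some row) :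
    (incr tab k l).g0P + (incr tab k l).g0N = row.aD * l.m00 ∧ (incr tab k l).g1P + (incr tab k l).g1N = row.aD * l.m11 ∧
    (incr tab k l).g2P + (incr tab k l).g2N = row.aD * l.m22 ∧ (incr tab k l).g3P + (incr tab k l).g3N = row.aD * l.m01 ∧
    (incr tab k l).g4P + (incr tab k l).g4N = row.aD * l.m02 ∧ (incr tab k l).g5P + (incr tab k l).g5N = row.aD * l.m12 := by
  unfold incr
  rw [h, hr]
  dsimp only [step4, acc0]
  simp only [Nat.mul_eq]
  refine ⟨?_, ?_, ?_, ?_, ?_, ?_⟩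
  · cases row.sD <;> simp [addP, addN]
  · cases row.sD <;> simp [addP, addN]
  · cases row.sD <;> simp [addP, addN]
  · cases row.sD <;> cases l.s01 <;> simp [addP, addN, sx]
  · cases row.sD <;> cases l.s02 <;> simp [addP, addN, sx]
  · cases row.sD <;> cases l.s12 <;> simp [addP, addN, sx]

/-! ## §4. Sums over the treated labels -/

/-- The eighteen numeric fields are additive under `Acc.add`. [formal bookkeeping] -/
theorem Acc.add_fields (a c : Acc) :
    (a.add c).vP = a.vP + c.vP ∧ (a.add c).vN = a.vN + c.vN ∧ (a.add c).dP = a.dP + c.dP ∧ (a.add c).dN = a.dN + c.dN ∧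
    (a.add c).sd = a.sd + c.sd ∧ (a.add c).g0P = a.g0P + c.g0P ∧ (a.add c).g0N = a.g0N + c.g0N ∧ (a.add c).g1P = a.g1P + c.g1P ∧
    (a.add c).g1N = a.g1N + c.g1N ∧ (a.add c).g2P = a.g2P + c.g2P ∧ (a.add c).g2N = a.g2N + c.g2N ∧ (a.add c).g3P = a.g3P + c.g3P ∧
    (a.add c).g3N = a.g3N + c.g3N ∧ (a.add c).g4P = a.g4P + c.g4P ∧ (a.add c).g4N = a.g4N + c.g4N ∧ (a.add c).g5P = a.g5P + c.g5P ∧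
    (a.add c).g5N = a.g5N + c.g5N ∧ (a.add c).cur = a.cur + c.cur :=
  ⟨rfl, rfl, rfl, rfl, rfl, rfl, rfl, rfl, rfl, rfl, rfl, rfl, rfl, rfl, rfl, rfl, rfl, rfl⟩

/-- A signed difference of two additive projections sums along the increment fold. [formal bookkeeping] -/
theorem proj_sub_foldl_add (P N : Acc → ℕ) (hP : ∀ a c, P (a.add c) = P a + P c) (hN : ∀ a c, N (a.add c) = N a + N c)
    (f : NL → Acc) (ls : List NL) (a : Acc) :
    (P (ls.foldl (fun acc l => acc.add (f l)) a) : ℤ) - (N (ls.foldl (fun acc l => acc.add (f l)) a) : ℤ) =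
      (P a : ℤ) - (N a : ℤ) + ((ls.map (fun l => P (f l))).sum : ℤ) - ((ls.map (fun l => N (f l))).sum : ℤ) := by
  rw [proj_foldl_add P hP f ls a, proj_foldl_add N hN f ls a]
  push_cast
  ring

end Summit.AtomisticToContinuum.Crystallization.Theorems.FrustratedLawDichotomyStrainedPatchHomLeafTableCheck
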